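import Summits.QuantumFields.BalabanUV.T4Continuum.Support.InsertionLinearClassLoc

/-!
# InsertionLinearClassLocWitness — kernel witness for ruling R22: on a sup-normed history space with `N` positions per scale the
# GLOBAL age budget `AgeBudget` forces `c ≥ N` (volume-extensive) while the PER-READ-OUT budget `AgeBudgetLoc` holds with `c = 1`
# for every `N`, and the consumer `insScaleBound_of_ageBudgetLoc` runs end to end
# (cell `pub-balaban`, T⁴ fan-out, `HOME/BINDER-OWNERS.md` row NE5, owner lineage t4-ne5-p1, gen 30)

HONEST FRAMING (T4-DAG PAGE 1).  Rung (B)+1 on ONE finite four-torus — NOT infinite volume, NOT a mass gap, NOT the Clay problem.  NE5 is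
NOT PRINTED and NOT PROVED (spine 0/9).  A TOY: nothing of Bałaban's series is modelled or asserted; 0 cite tags.  HONEST DEPENDENCY (cell,
verbatim): continuum YM on T⁴ ⇐ BetaPertH ∧ nine spine estimates (0/9 proved); BetaPertH ⇐ (D1) ∧ (D4) ∧ CAP+tail; G-an2-4 gates asym, D1
and NE2/3/4.

WHAT THIS MODULE IS (the G-ne5p2-5 lesson applied to the owner's own ruling: a shape is tested by instantiating it).  Toy carriers with
domains `(j, x)` = (scale, position), history space `ℕ →ᵇ ℂ` (bounded tables, SUP norm — the KIND of the Hist of record `B13HistDatum.Hist F`),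
linear insertion reading at step `k` the domains `(j, x)`, `j < k`, `x < N`, with ENTRY-LOCAL vectors `ω^{k−1−j} • 𝟙_x`:
* `volToy_ageBudget_le` — the GLOBAL binder `InsertionLinearClass.AgeBudget … c ω` implies `N ≤ c` (at `k = 1`, `j = 0` the weighted ℓ¹ sum
  is `N`): volume-extensive;
* `volToy_ageBudgetLoc` — the PER-READ-OUT binder `AgeBudgetLoc … 1 ω (evalCLM)` holds with `c = 1` for EVERY `N` (`0 ≤ ω ≤ 1`);
* `volToy_insScaleBound` — hence `StepModel.InsScaleBound univ 0 E₁ 1 ω` for the toy step model by `insScaleBound_of_ageBudgetLoc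
  norming_evalCLM` — the R22 consumer end to end, constant independent of `N`.
0 sorry; axioms ⊆ {propext, Classical.choice, Quot.sound}.
-/

noncomputable section

open scoped BigOperators
open Finset

namespace Summit.QuantumFields.BalabanUV.T4Continuum.InsertionLinearClassLocWitness

open Literature.MathematicalPhysics.QuantumFieldTheory.Balaban1983to89.T4OutputRate (Carriers)
open Literature.MathematicalPhysics.QuantumFieldTheory.Balaban1983to89.T4InputCauchyRateData (StepModel)
open Summit.QuantumFields.BalabanUV.T4Continuum.InsertionLinearClass (LinearInsertion)
open Summit.QuantumFields.BalabanUV.T4Continuum.InsertionLinearClass.LinearInsertion (Reads AgeBudget)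
open Summit.QuantumFields.BalabanUV.T4Continuum.InsertionLinearClassLoc

/-- Toy carriers: domains `(j, x)` = (scale, position), tree length `0`, trivial backgrounds. [folklore] -/
abbrev volToyCarriers : Carriers where
  Dom := ℕ × ℕ
  scale := Prod.fst
  d := fun _ => 0
  d_nonneg := fun _ => le_rfl
  BgA := Unit
  BgB := Unit
  gauge := fun _ _ => 0
  gauge_nonneg := fun _ _ => le_rfl
  transport := fun u => u

/-- Toy history space: bounded tables on `ℕ` with the SUP norm. [folklore] -/
abbrev ToyHist : Type := BoundedContinuousFunction ℕ ℂ

/-- The indicator table of position `x`. [folklore] -/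
def ind (x : ℕ) : ToyHist :=
  BoundedContinuousFunction.ofNormedAddCommGroupDiscrete (fun y => if y = x then (1 : ℂ) else 0) 1 fun y => by
    by_cases h : y = x <;> simp [h]

/-- Entries of the indicator table. [folklore] -/
@[simp] theorem ind_apply (x y : ℕ) : ind x y = if y = x then 1 else 0 := rfl

/-- The toy linear insertion with `N` positions per scale: at step `k` the domains `(j, x)`, `j < k`, `x < N`, vectors `ω^{k−1−j} • 𝟙_x`,
no base part. [folklore] -/
def volToyIns (N : ℕ) (ω : ℝ) : LinearInsertion volToyCarriers ToyHist where
  dom k := Finset.range k ×ˢ Finset.range N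
  dom_lt _ _ hY := Finset.mem_range.1 (Finset.mem_product.1 hY).1
  base _ _ _ := 0
  vec _ _ k Y := (((ω ^ (k - 1 - Y.1) : ℝ)) : ℂ) • ind Y.2

/-- The toy step model: scalar operators, zero output, both insertions the toy linear insertion, unit margins. [folklore] -/
def volToyStep (N : ℕ) (ω : ℝ) : StepModel volToyCarriers ℂ ToyHist where
  Out := fun _ _ _ _ => 0
  opA := fun _ _ _ => 0
  opB := fun _ _ _ => 0
  insA := (volToyIns N ω).ins
  insB := (volToyIns N ω).ins
  Base := fun _ _ _ => Set.univ
  rOp := fun _ => 1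
  rHist := fun _ => 1
  rOp_pos := fun _ => one_pos
  rHist_pos := fun _ => one_pos

/-- The toy step model reads the toy insertion (run A). [folklore] -/
theorem volToy_reads (N : ℕ) (ω : ℝ) : Reads (volToyIns N ω) (volToyStep N ω) Set.univ := fun _ _ _ _ _ => rfl

/-- The scale-`j` domains read at step `k > j` are `{j} × {0, …, N − 1}`. [folklore] -/
theorem filter_dom_eq {N k j : ℕ} (hj : j < k) (ω : ℝ) :
    ((volToyIns N ω).dom k).filter (fun Y : ℕ × ℕ => Y.1 = j) = ({j} : Finset ℕ) ×ˢ Finset.range N := by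
  ext ⟨a, x⟩
  simp only [volToyIns, Finset.mem_filter, Finset.mem_product, Finset.mem_range, Finset.mem_singleton]
  constructor
  · rintro ⟨⟨-, hx⟩, rfl⟩; exact ⟨rfl, hx⟩
  · rintro ⟨rfl, hx⟩; exact ⟨⟨hj, hx⟩, rfl⟩

/-- The norm of the toy's scale-`j` vector at position `x`: `ω^{k−1−j}` (`0 ≤ ω`). [folklore] -/
theorem norm_vec {N : ℕ} {ω : ℝ} (hω : 0 ≤ ω) (k : ℕ) (Y : ℕ × ℕ) :
    ‖(volToyIns N ω).vec (fun _ => 0) () k Y‖ = ω ^ (k - 1 - Y.1) := by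
  change ‖(((ω ^ (k - 1 - Y.1) : ℝ)) : ℂ) • ind Y.2‖ = _
  have hind : ‖ind Y.2‖ = 1 := by
    refine le_antisymm ((BoundedContinuousFunction.norm_le zero_le_one).2 fun y => ?_) ?_
    · by_cases h : y = Y.2 <;> simp [h]
    · simpa using (ind Y.2).norm_coe_le_norm Y.2
  rw [norm_smul, Complex.norm_real, Real.norm_of_nonneg (pow_nonneg hω _), hind, mul_one]

/-- **THE GLOBAL AGE BUDGET IS VOLUME-EXTENSIVE**: `AgeBudget (volToyIns N ω) (volToyStep N ω) univ 0 c ω ⟹ N ≤ c` — at step `1`, scale `0`,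
the `e^{0}`-weighted ℓ¹ sum of the `N` unit vectors is `N`, the right side `1·c·ω⁰ = c`. [folklore] -/
theorem volToy_ageBudget_le {N : ℕ} {ω c : ℝ} (hω : 0 ≤ ω) (h : AgeBudget (volToyIns N ω) (volToyStep N ω) Set.univ 0 c ω) :
    (N : ℝ) ≤ c := by
  have h1 := h 1 (fun _ => 0) (Set.mem_univ _) () 0 one_pos
  rw [filter_dom_eq one_pos] at h1
  have hsum : ∑ Y ∈ ({0} : Finset ℕ) ×ˢ Finset.range N,
      Real.exp (-((0 : ℝ) * volToyCarriers.d Y)) * ‖(volToyIns N ω).vec (fun _ => 0) () 1 Y‖ = N := by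
    rw [Finset.sum_product, Finset.sum_singleton]
    simp_rw [zero_mul, neg_zero, Real.exp_zero, one_mul, norm_vec hω]
    simp
  have hr : (volToyStep N ω).rHist 1 = 1 := rfl
  rw [hsum, hr, one_mul, pow_zero, mul_one] at h1
  exact h1

/-- **THE PER-READ-OUT AGE BUDGET HOLDS WITH `c = 1` FOR EVERY `N`** (`0 ≤ ω ≤ 1`): at read-out (position) `e` only the vector at position `e`
contributes, with modulus `ω^{k−1−j} ≤ 1·ω^{k−1−j}`. [folklore] -/
theorem volToy_ageBudgetLoc (N : ℕ) {ω : ℝ} (hω : 0 ≤ ω) :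
    AgeBudgetLoc (volToyIns N ω) (volToyStep N ω) Set.univ 0 1 ω fun e : ℕ => BoundedContinuousFunction.evalCLM ℂ e := by
  intro k g _ U j hj e
  obtain ⟨⟩ := U
  have hg : (volToyIns N ω).vec g () k = (volToyIns N ω).vec (fun _ => 0) () k := rfl
  rw [filter_dom_eq hj, Finset.sum_product, Finset.sum_singleton, hg]
  have hr : (volToyStep N ω).rHist k = 1 := rfl
  rw [hr, one_mul, one_mul]
  have hterm : ∀ x ∈ Finset.range N, Real.exp (-((0 : ℝ) * volToyCarriers.d (j, x))) *
      ‖BoundedContinuousFunction.evalCLM ℂ e ((volToyIns N ω).vec (fun _ => 0) () k (j, x))‖ =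
        if x = e then ω ^ (k - 1 - j) else 0 := by
    intro x _
    rw [zero_mul, neg_zero, Real.exp_zero, one_mul, BoundedContinuousFunction.evalCLM_apply]
    change ‖((((ω ^ (k - 1 - j) : ℝ)) : ℂ) • ind x) e‖ = _
    rw [BoundedContinuousFunction.smul_apply, ind_apply, smul_eq_mul]
    by_cases hx : x = e
    · subst hx; simp [abs_of_nonneg hω]
    · have : ¬ e = x := fun h' => hx h'.symm
      simp [this, hx]
  rw [Finset.sum_congr rfl hterm, Finset.sum_ite_eq' (Finset.range N) e (fun _ => ω ^ (k - 1 - j))]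
  split_ifs
  · exact le_rfl
  · exact pow_nonneg hω _

/-- **THE R22 CONSUMER END TO END, CONSTANT INDEPENDENT OF `N`**: `StepModel.InsScaleBound univ 0 E₁ 1 ω` for the toy step model from the
per-read-out budget through `insScaleBound_of_ageBudgetLoc norming_evalCLM` (`0 ≤ ω`, `0 ≤ E₁`). [folklore] -/
theorem volToy_insScaleBound (N : ℕ) {ω E₁ : ℝ} (hω : 0 ≤ ω) (hE₁ : 0 ≤ E₁) :
    (volToyStep N ω).InsScaleBound Set.univ 0 E₁ 1 ω :=
  insScaleBound_of_ageBudgetLoc norming_evalCLM (volToy_reads N ω) (volToy_ageBudgetLoc N hω) zero_le_one hω hE₁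

/-- The two constants side by side: the per-read-out budget's `c = 1` versus the global budget's `c ≥ N` — for `N = 2` already the global
binder with `c = 1` is FALSE. [folklore] -/
theorem volToy_not_ageBudget_one {ω : ℝ} (hω : 0 ≤ ω) : ¬ AgeBudget (volToyIns 2 ω) (volToyStep 2 ω) Set.univ 0 1 ω :=
  fun h => by have := volToy_ageBudget_le hω h; norm_num at this

end Summit.QuantumFields.BalabanUV.T4Continuum.InsertionLinearClassLocWitness

end
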